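import Mathlib.Tactic

/-!
# Helper lemmas for ES `EngineSupplyAtTwo`

Generic `AddCommGroup` lemmas to work around the ℤ-smul instance mismatch on `galH1Torsion`.
BSD is NOT proved. U1 is NOT proved.
-/

variable {G : Type*} [AddCommGroup G]

/-- c-branch exponent form (defect 3): `2^b • c + 2^b • c = 2^(b+1) • c`. -/
theorem pow_smul_add_pow_smul (c : G) (b : ℕ) :
    ((2 ^ b : ℕ) : ℤ) • c + ((2 ^ b : ℕ) : ℤ) • c = ((2 ^ (b + 1) : ℕ) : ℤ) • c := by
  rw [← add_zsmul]
  congr 1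
  have h : (2 : ℤ) ^ b + (2 : ℤ) ^ b = (2 : ℤ) ^ (b + 1) := by ring
  simp only [Nat.cast_ofNat, Nat.cast_pow] at h ⊢
  convert h using 1

/-- c-branch full identity (defect 3): sub/add pattern. -/
theorem c_branch_identity (c : G) {k : ℕ} (y : Fin k → G) (b' : Fin k → ℤ) (b : ℕ) :
    (((2 ^ b : ℕ) : ℤ) • c - ∑ i : Fin k, b' i • y i) +
      (((2 ^ b : ℕ) : ℤ) • c + ∑ i : Fin k, b' i • y i) =
      ((2 ^ (b + 1) : ℕ) : ℤ) • c := by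
  rw [sub_add_add_cancel]
  exact pow_smul_add_pow_smul c b

/-- z-branch identity (defect 2): the key rewrite. -/
theorem z_branch_identity {k : ℕ} (z : G) (y : Fin k → G) (b' : Fin k → ℤ) (a : ℕ) :
    ((2 ^ (a + 4) : ℕ) : ℤ) • z - ∑ i : Fin k, (16 * b' i) • y i =
      (2 : ℤ) • (((9 : ℤ) - 1) • (((2 ^ a : ℕ) : ℤ) • z - ∑ i : Fin k, b' i • y i)) := by
  simp only [smul_sub, Finset.smul_sum, smul_smul]
  congr 1
  · congr 1
    push_cast
    ring
  · apply Finset.sum_congr rfl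
    intro i _
    congr 1
    ring
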